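import Summits.Ventures.YMGap.BEDoor.Receivers

/-!
# BEDoor / ClustersWith — §8c OUTPUT = `RobustBall.ClustersWith` VERBATIM, §9b cutoff and frozen flows
# (module 09/11 of the Bakry–Émery door, LIFT edition v8.3 = parts `ClustersWith` (v8.2 module 13); cell `ym-beyond`, seat P4)

HONEST FRAMING (cell `ym-beyond`, seat P4 «Hessian-currency receiver», lens Y2; HUMAN RULINGS D-0035 / D-0037; memo `HOME/ROUTE-P4Y2.md` v8.1 +
g10 addendum, spec `HOME/ROUTE-P4Y2-LIFT-SPEC-v83.md`; LIFT edition v8.3 = the v8.2 module bodies of `HOME/ROUTE-P4Y2-Sketch.lean` v8.1, byte-identical and in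
order, re-packed into 11 ≤ 400-line modules (fewer olean round-trips; director-ym line №2 (B)); the g10 appendix `OpenStrip` is a separate, UNQUEUED HOME file (line №3 (D))).  FINITE-LATTICE
statements at STRONG effective coupling: a RECEIVER («door») in HESSIAN (Bakry–Émery) currency for renormalisation-group output, typed over the
tree's generic clustering chain `Thresholds/SharpClustering*` + `Thresholds/LatticeBakryEmery*`, complementary to the Dobrushin-currency door
`YM4Door/*` (LITERALLY the same INPUT predicate `QuasiLocalGaugePerturbation.HasAnalyticNormLE … stripDomain`, the same OUTPUT predicate
`RobustBall.ClustersWith`; no residual hypothesis: Osgood regularity is the tree's `Literature.Analysis.Complex.SCV.contDiffOn_infty`,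
part `Osgood` of module `AnalyticStrip`).  Nothing here is a statement about `β → ∞`, the continuum limit or the Clay problem; NO effective action is asserted to be at
the door (that INPUT is not in print for `d = 4`); the verdict «the two windows do not meet» is unchanged in this currency.
WHAT THIS IS NOT (ladder rung R2d; director-ym line №2 (B)): every door of this LIFT is an entry on the STRONG-COUPLING BANK of THE NUMBER —
finite-lattice exponential clustering at SMALL `|β|` and small strip norm `η` of the perturbation (`SU(2)`, `d = 4`: `16.2|β| + 4.4η < 1`, module `SU2`,
conclusion literally `RobustBall.ClustersWith`) — NOT clustering at weak coupling, NOT a statement at large `β`, NOT the mass gap.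
No conjecture name, no `sorry`, no axiom beyond the standard three; every theorem is bookkeeping over the tree. [folklore]
References: H. Shen, R. Zhu, X. Zhu, CMP 400 (2023) 805 (arXiv:2204.12737) Thm 1.2, Cor. 4.4/4.11; D. Bakry, M. Émery, LNM 1123 (1985);
T. Bałaban, CMP 109 (1987) 249, (1.18)–(1.22) (analyticity format); L. Hörmander, An Introduction to Complex Analysis in Several Variables
(1973) Thm 2.2.1/2.2.6 (Osgood); E. J. McShane, Bull. AMS 40 (1934) 837 (Lipschitz extension).

THIS MODULE, part `ClustersWith` (§8c OUTPUT = `RobustBall.ClustersWith` VERBATIM, §9b cutoff and frozen flows):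
`perturbedMeasure_cov_le_of_format_sep`, ★★★ `clustersWith_of_format` (format data + door ⇒ `RobustBall.ClustersWith W (Nβ) K⁻¹ κ`; ε → 0 through
`SharpClustering.abs_cov_sub_cov_le`); `exists_contDiff_cutoff` (χ = 1 on a compact `K`, `tsupport χ ⊆ thickening r K`),
`contDiff_mul_of_tsupport_subset`; `flowCfg`, `differentiable_flowCfg`, `flowPSU`, `flowCfg_ofReal`, `flowPSU_eq_of_mem`, `norm_flowCfg_sub_lt` (the
frozen flow stays in the strip for `|z| < log (1 + r)`, by unitary invariance of the Frobenius norm).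
-/

noncomputable section

open scoped Matrix ComplexConjugate BigOperators Matrix.Norms.Frobenius ContDiff Topology
open Matrix Complex Finset MeasureTheory Filter
open Literature.MathematicalPhysics.QuantumFieldTheory
open Literature.MathematicalPhysics.QuantumFieldTheory.SUNBakryEmery (SUN FrameIdx frame)

namespace Summit.Ventures.YMGap.BEDoor

open Summit.Ventures.YMGap Summit.Ventures.YMGap.LatticeBakryEmery Summit.Ventures.YMGap.SharpClustering
open Summit.Ventures.YMGap.HessianSharp

universe u

/-! ### §8b. The torus distance function; §8c. `ClustersWith` from format data -/

section ClustersWithOutput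

variable {d N : ℕ} {L : ℕ} [NeZero L]

open scoped ProbabilityTheory
open ProbabilityTheory
open Literature.MathematicalPhysics.QuantumLattice (fundamentalRep continuous_fundamentalRep)
open Literature.Probability.LatticeModels.DobrushinMetric (IsLipBound)
open Summit.Ventures.YMGap.SharpClustering (abs_cov_sub_cov_le)

/-- §8b ★ **The receiver with torus separation instead of an abstract distance function.**  As `perturbedMeasure_cov_le_of_format'`,
with (i) the oscillation hypothesis on `D` replaced by a bound `δ i` on the TORUS DIAMETER of each term's link set `X i`, and (ii) the
`D`-hypotheses on the observables replaced by torus separation `≥ m` of the supports of their Lipschitz data; `D e := dist(e, supp δv)`. [folklore assembly] [folklore] -/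
theorem perturbedMeasure_cov_le_of_format_sep {Λ₀ : ℝ} (hH : WilsonHessianBound d N Λ₀) (hN : N ≠ 0) (β : ℝ) (hL : 1 < L)
    {b : ℕ} (W : QuasiLocalGaugePerturbation d L (SUN N) b)
    {K : Type*} (s : Finset K) {E : K → Cfg (Edge d L) N → ℝ} (hE : ∀ i, ContDiff ℝ ∞ (E i))
    (hW : ∀ U : PSU (Edge d L) N, (∑ i ∈ s, E i) (emb U) = -W.total U)
    {X : K → Finset (Edge d L)} {M : K → ℝ} {r : ℝ} (hr : 0 < r) (hM : ∀ i ∈ s, 0 ≤ M i)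
    (hSB : ∀ i ∈ s, StripBoundOn (E i) (X i) (M i) r)
    {η : ℝ} (hη : ∀ e, hessLoad s X (fun i => 2 * M i / r ^ 2) e ≤ η)
    {κ Θ : ℝ} (hκ : 0 ≤ κ) {δ : K → ℝ}
    (hδ : ∀ i ∈ s, ∀ e ∈ X i, ∀ e' ∈ X i, (torusNorm (e.1 - e'.1) : ℝ) ≤ δ i)
    (hΘ : ∀ e, ∑ i ∈ s, (if e ∈ X i then 4 * M i / r ^ 2 * (X i).card * (Real.exp (κ * δ i) - 1) else 0) ≤ Θ)
    (hK : 0 < (N : ℝ) / 2 - ((N : ℝ) * |β| * Λ₀ + η) -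
      (max (6 * ((d : ℝ) - 1) * N * |β|) 0 * (Real.exp κ - 1) + Θ))
    {u v : Cfg (Edge d L) N → ℝ} (hu : ContDiff ℝ ∞ u) (hv : ContDiff ℝ ∞ v)
    {δu δv : Edge d L → ℝ} (hδu : ∀ e, 0 ≤ δu e) (hδv : ∀ e, 0 ≤ δv e)
    (hLu : LinkLipschitz u δu) (hLv : LinkLipschitz v δv) (m : ℕ)
    (hsep : ∀ e e', δu e ≠ 0 → δv e' ≠ 0 → m ≤ torusNorm (e.1 - e'.1)) :
    |cov[fun U => u (emb U), fun U => v (emb U); W.perturbedMeasure (fundamentalRep (Fin N)) ((N : ℝ) * β)]| ≤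
      Real.exp (-κ * m) * (∑ e, δu e) * (∑ e, δv e) /
        ((N : ℝ) / 2 - ((N : ℝ) * |β| * Λ₀ + η) - (max (6 * ((d : ℝ) - 1) * N * |β|) 0 * (Real.exp κ - 1) + Θ)) := by
  classical
  set Sv : Finset (Edge d L) := univ.filter fun e => δv e ≠ 0 with hSv
  by_cases hne : Sv.Nonempty
  · set D : Edge d L → ℕ := fun e => Sv.inf' hne fun e' => torusNorm (e.1 - e'.1) with hD
    have hosc : ∀ e e' : Edge d L, D e ≤ D e' + torusNorm (e.1 - e'.1) := by
      intro e e'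
      obtain ⟨t, ht, hDt⟩ := exists_mem_eq_inf' hne (fun e'' => torusNorm (e'.1 - e''.1))
      have h1 : D e ≤ torusNorm (e.1 - t.1) := inf'_le _ ht
      have h2 : torusNorm (e.1 - t.1) ≤ torusNorm (e.1 - e'.1) + torusNorm (e'.1 - t.1) := torusNorm_sub_le _ _ _
      have h4 : D e' = torusNorm (e'.1 - t.1) := hDt
      omega
    have hD1 : ∀ e e', e' ∈ linkNbrT e → D e ≤ D e' + 1 := fun e e' he' =>
      (hosc e e').trans (Nat.add_le_add_left (torusNorm_sub_le_one_of_mem_linkNbrT he') _)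
    have hDv : ∀ e, δv e ≠ 0 → D e = 0 := by
      intro e he
      have hmem : e ∈ Sv := by rw [hSv]; exact mem_filter.2 ⟨mem_univ _, he⟩
      have h1 : D e ≤ torusNorm (e.1 - e.1) := inf'_le _ hmem
      rw [sub_self, torusNorm_zero] at h1
      exact Nat.le_zero.1 h1
    have hDu : ∀ e, δu e ≠ 0 → m ≤ D e := by
      intro e he
      refine (le_inf'_iff hne _).2 fun e' he' => ?_
      have h1 : e' ∈ univ.filter (fun e => δv e ≠ 0) := by rw [hSv] at he'; exact he'
      exact hsep e e' he (mem_filter.1 h1).2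
    have hδ' : ∀ i ∈ s, ∀ e ∈ X i, ∀ e' ∈ X i, |(D e : ℝ) - D e'| ≤ δ i := by
      intro i hi e he e' he'
      have h1 : (D e : ℝ) ≤ D e' + torusNorm (e.1 - e'.1) := by exact_mod_cast hosc e e'
      have h2' := hosc e' e
      have hsym : torusNorm (e'.1 - e.1) = torusNorm (e.1 - e'.1) := by rw [← torusNorm_neg, neg_sub]
      rw [hsym] at h2'
      have h2 : (D e' : ℝ) ≤ D e + torusNorm (e.1 - e'.1) := by exact_mod_cast h2'
      have h3 := hδ i hi e he e' he'
      rw [abs_le]; constructor <;> linarith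
    exact perturbedMeasure_cov_le_of_format' hH hN β hL W s hE hW hr hM hSB hη D hD1 hκ hδ' hΘ hK hu hv hδu hδv
      hLu hLv hDv hDu
  · have hδv0 : ∀ e, δv e = 0 := by
      intro e
      by_contra h
      exact hne ⟨e, by rw [hSv]; exact mem_filter.2 ⟨mem_univ _, h⟩⟩
    have h0 := perturbedMeasure_cov_le_of_format' hH hN β hL W s hE hW hr hM hSB hη (fun _ => 0)
      (fun _ _ _ => by simp) hκ (δ := δ)
      (fun i hi e he e' he' => by
        simp only [Nat.cast_zero, sub_self, abs_zero]
        exact (Nat.cast_nonneg _).trans (hδ i hi e he e' he'))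
      hΘ hK hu hv hδu hδv hLu hLv (fun _ _ => rfl) (m := 0) (fun _ _ => le_rfl)
    have hs0 : ∑ e, δv e = 0 := sum_eq_zero fun e _ => hδv0 e
    rw [hs0, mul_zero, zero_div] at h0 ⊢
    exact h0

/-- §8c ★★★ **THE HESSIAN DOOR WITH OUTPUT `RobustBall.ClustersWith` — format data alone.**  For a member `W` of the robustness
ball (block scale `1`, gauge group `SU(N)`, `N ≥ 1`) whose total action is minus a finite sum of smooth strip-format terms
`E i` (link sets `X i` of torus diameter `≤ δ i`, strip bounds `M i` at width `r`), on every torus of side `L ≥ 2`: if the door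
`K := N/2 − (N|β|Λ₀ + η) − (max(6(d−1)N|β|,0)(e^κ − 1) + Θ) > 0` is open (`η` = Hessian load, `Θ` = inhomogeneity load), then
`ClustersWith W (Nβ) K⁻¹ κ` — exponential clustering at rate `κ` with Lipschitz seminorms, for ALL measurable bounded observables,
uniformly in the volume.  (Lipschitz → smooth by §8a inside the proof; `ε → 0` by `SharpClustering.abs_cov_sub_cov_le`.) [folklore assembly] [folklore] -/
theorem clustersWith_of_format {Λ₀ : ℝ} (hH : WilsonHessianBound d N Λ₀) (hN : N ≠ 0) (β : ℝ) (hL : 1 < L)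
    (W : RobustBall.Perturbation d L N)
    {K : Type*} (s : Finset K) {E : K → Cfg (Edge d L) N → ℝ} (hE : ∀ i, ContDiff ℝ ∞ (E i))
    (hW : ∀ U : PSU (Edge d L) N, (∑ i ∈ s, E i) (emb U) = -W.total U)
    {X : K → Finset (Edge d L)} {M : K → ℝ} {r : ℝ} (hr : 0 < r) (hM : ∀ i ∈ s, 0 ≤ M i)
    (hSB : ∀ i ∈ s, StripBoundOn (E i) (X i) (M i) r)
    {η : ℝ} (hη : ∀ e, hessLoad s X (fun i => 2 * M i / r ^ 2) e ≤ η)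
    {κ Θ : ℝ} (hκ : 0 ≤ κ) {δ : K → ℝ}
    (hδ : ∀ i ∈ s, ∀ e ∈ X i, ∀ e' ∈ X i, (torusNorm (e.1 - e'.1) : ℝ) ≤ δ i)
    (hΘ : ∀ e, ∑ i ∈ s, (if e ∈ X i then 4 * M i / r ^ 2 * (X i).card * (Real.exp (κ * δ i) - 1) else 0) ≤ Θ)
    (hK : 0 < (N : ℝ) / 2 - ((N : ℝ) * |β| * Λ₀ + η) -
      (max (6 * ((d : ℝ) - 1) * N * |β|) 0 * (Real.exp κ - 1) + Θ)) :
    RobustBall.ClustersWith W ((N : ℝ) * β)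
      (1 / ((N : ℝ) / 2 - ((N : ℝ) * |β| * Λ₀ + η) - (max (6 * ((d : ℝ) - 1) * N * |β|) 0 * (Real.exp κ - 1) + Θ))) κ := by
  classical
  set Kd : ℝ := (N : ℝ) / 2 - ((N : ℝ) * |β| * Λ₀ + η) - (max (6 * ((d : ℝ) - 1) * N * |β|) 0 * (Real.exp κ - 1) + Θ)
    with hKd
  intro f g Δf Δg δf δg n hfm hgm hfdep hgdep hfb hgb hfL hgL hsep
  set μW := W.perturbedMeasure (fundamentalRep (Fin N)) ((N : ℝ) * β) with hμW
  haveI := isProbabilityMeasure_perturbedMeasure W ((N : ℝ) * β)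
  -- restrict the Lipschitz data to `Δf`, `Δg`
  set δu : Edge d L → ℝ := fun e => if e ∈ Δf then δf e else 0 with hδu
  set δv : Edge d L → ℝ := fun e => if e ∈ Δg then δg e else 0 with hδv
  have hfL' : IsLipBound suFrobDist f δu := hfL.restrict hfdep
  have hgL' : IsLipBound suFrobDist g δv := hgL.restrict hgdep
  have hsu : ∑ e, δu e = ∑ x ∈ Δf, δf x := by rw [hδu, Finset.sum_ite_mem, univ_inter]
  have hsv : ∑ e, δv e = ∑ y ∈ Δg, δg y := by rw [hδv, Finset.sum_ite_mem, univ_inter]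
  have hsep' : ∀ e e', δu e ≠ 0 → δv e' ≠ 0 → n ≤ torusNorm (e.1 - e'.1) := by
    intro e e' he he'
    have h1 : e ∈ Δf := by
      by_contra h
      exact he (by simp [hδu, h])
    have h2 : e' ∈ Δg := by
      by_contra h
      exact he' (by simp [hδv, h])
    exact hsep e h1 e' h2
  obtain ⟨Mf, hMf⟩ := hfb
  obtain ⟨Mg, hMg⟩ := hgb
  have hMf0 : 0 ≤ Mf := (abs_nonneg _).trans (hMf 1)
  have hMg0 : 0 ≤ Mg := (abs_nonneg _).trans (hMg 1)
  set B : ℝ := Real.exp (-κ * n) * (∑ e, δu e) * (∑ e, δv e) / Kd with hB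
  -- the `ε`-argument: smooth the observables, apply the door, compare covariances
  have key : ∀ ε : ℝ, 0 < ε → |cov[f, g; μW]| ≤ B + 2 * (ε * Mg + (Mf + ε) * ε) := by
    intro ε hε
    obtain ⟨u, hu, hLu, huf⟩ := exists_contDiff_linkLipschitz_approx ⟨Mf, hMf⟩ hfL' hε
    obtain ⟨v, hv, hLv, hvg⟩ := exists_contDiff_linkLipschitz_approx ⟨Mg, hMg⟩ hgL' hε
    have hdoor := perturbedMeasure_cov_le_of_format_sep hH hN β hL W s hE hW hr hM hSB hη hκ hδ hΘ hK hu hv hfL'.nonneg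
      hgL'.nonneg hLu hLv n hsep'
    have hua : ∀ U, |u (emb U)| ≤ Mf + ε := fun U => by
      have h1 := hMf U
      have h2 := huf U
      have h3 : |u (emb U)| ≤ |f U| + |u (emb U) - f U| := by
        have := abs_add_le (f U) (u (emb U) - f U)
        rwa [add_sub_cancel] at this
      linarith
    have hP := abs_cov_sub_cov_le (μ := μW) hfm.aestronglyMeasurable (continuous_restrict hu).aestronglyMeasurable
      hgm.aestronglyMeasurable (continuous_restrict hv).aestronglyMeasurable hua hMg
      (fun U => by rw [abs_sub_comm]; exact huf U) (fun U => by rw [abs_sub_comm]; exact hvg U)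
    have h3 : |cov[f, g; μW]| ≤ |cov[fun U => u (emb U), fun U => v (emb U); μW]| +
        |cov[f, g; μW] - cov[fun U => u (emb U), fun U => v (emb U); μW]| := by
      have := abs_add_le (cov[fun U => u (emb U), fun U => v (emb U); μW])
        (cov[f, g; μW] - cov[fun U => u (emb U), fun U => v (emb U); μW])
      rwa [add_sub_cancel] at this
    have h4 : |cov[fun U => u (emb U), fun U => v (emb U); μW]| ≤ B := hdoor
    linarith
  have hfin : |cov[f, g; μW]| ≤ B := by
    refine le_of_forall_pos_le_add fun ε₀ hε₀ => ?_
    have hS : 0 < 2 * (Mg + Mf + 2) := by linarith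
    set ε : ℝ := min 1 (ε₀ / (2 * (Mg + Mf + 2))) with hεdef
    have hε : 0 < ε := lt_min one_pos (div_pos hε₀ hS)
    have hε1 : ε ≤ 1 := min_le_left _ _
    have hε2 : ε ≤ ε₀ / (2 * (Mg + Mf + 2)) := min_le_right _ _
    have hε2' : ε * (2 * (Mg + Mf + 2)) ≤ ε₀ := (le_div_iff₀ hS).1 hε2
    have h := key ε hε
    have h' : 2 * (ε * Mg + (Mf + ε) * ε) ≤ ε₀ := by nlinarith
    linarith
  calc |cov[f, g; μW]| ≤ B := hfin
    _ = 1 / Kd * (∑ y ∈ Δg, δg y) * (∑ x ∈ Δf, δf x) * Real.exp (-κ * n) := by rw [hB, hsu, hsv]; ring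

end ClustersWithOutput

/-! ## §9 (v8/v8.1).  INPUT from the analyticity strip — LITERALLY P2's `HasAnalyticNormLE … stripDomain`

P2's bridge `YMBeyond.P2.Y2.clustersWith_of_strip` consumes `W.HasAnalyticNormLE (fundamentalRep (Fin N)) (fun _ => stripDomain _ r) κ η`:
every activity `W_X` is the restriction of a function holomorphic (`DifferentiableOn ℂ`) and bounded by `M_X` on the complex strip of
width `r` around `SU(N)^{E}`, `sup_y Σ_{X ∋ y} M_X e^{κ|X|} ≤ η`.  §9 derives the Hessian door's format data from EXACTLY this predicate:
§9a imports OSGOOD REGULARITY from the tree (`osgood_contDiffOn` := `Literature.Analysis.Complex.SCV.contDiffOn_infty`: Fréchet-holomorphic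
on an open subset of a finite-dimensional complex normed space ⇒ `C^∞`; Mathlib itself has the one-variable `DifferentiableOn.analyticOnNhd`
only), which v7 had to carry as the hypothesis `HoloAnalytic` and v8 re-proved in place; a smooth
cutoff `χ` (`= 1` on the group, supported in the strip) makes `E_X := −χ · Re F_X` a smooth ambient term restricting to `−W_X`; the
one-parameter flows `g e^{sV}` with the links off `X` frozen certify `StripBoundOn E_X X̃ M_X r''` for every `r'' < log (1 + r)`; the loads
are `η_H ≤ 2η/r''²` and `Θ ≤ 16 d κ' η/(e² r''² (κ − κ')²)` for any rate `κ' < κ`; thin supports (`diam X ≤ |X| − 1` for active `X`, P2's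
`hsupp`) bound the oscillation.  No residual hypothesis. -/

section Cutoff

variable {E : Type*} [NormedAddCommGroup E] [NormedSpace ℝ E] [FiniteDimensional ℝ E]

/-- **Smooth cutoff**: for any set `K` and `r > 0` there is a `C^∞` function `χ`, `= 1` on `K`, supported (with its closure)
in the open `r`-thickening of `K`.  Two smooth Urysohn functions (`IsOpen.exists_contDiff_support_eq`) and a quotient. [folklore] -/
theorem exists_contDiff_cutoff (K : Set E) {r : ℝ} (hr : 0 < r) :
    ∃ χ : E → ℝ, ContDiff ℝ ∞ χ ∧ (∀ x ∈ K, χ x = 1) ∧ tsupport χ ⊆ Metric.thickening r K := by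
  obtain ⟨f₁, hs₁, hf₁, hr₁⟩ :=
    (Metric.isOpen_thickening (δ := r / 2) (E := K)).exists_contDiff_support_eq (n := (⊤ : ℕ∞))
  obtain ⟨f₂, hs₂, hf₂, hr₂⟩ :=
    (Metric.isClosed_cthickening (δ := r / 4) (E := K)).isOpen_compl.exists_contDiff_support_eq (n := (⊤ : ℕ∞))
  have h1 : ∀ x, 0 ≤ f₁ x := fun x => (hr₁ ⟨x, rfl⟩).1
  have h2 : ∀ x, 0 ≤ f₂ x := fun x => (hr₂ ⟨x, rfl⟩).1
  have hpos : ∀ x, f₁ x + f₂ x ≠ 0 := by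
    intro x hx
    have hf1 : f₁ x = 0 := by linarith [h1 x, h2 x]
    have hf2 : f₂ x = 0 := by linarith [h1 x, h2 x]
    have hx2 : x ∈ Metric.cthickening (r / 4) K := by
      by_contra h
      have : x ∈ Function.support f₂ := by rw [hs₂]; exact h
      exact this hf2
    have hx1 : x ∈ Function.support f₁ := by
      rw [hs₁]
      exact Metric.cthickening_subset_thickening' (by linarith) (by linarith) K hx2
    exact hx1 hf1
  refine ⟨fun x => f₁ x / (f₁ x + f₂ x), hf₁.div (hf₁.add hf₂) hpos, fun x hx => ?_, ?_⟩
  · have hx2 : x ∈ Metric.cthickening (r / 4) K := Metric.self_subset_cthickening K hx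
    have hf2 : f₂ x = 0 := by
      by_contra h
      have : x ∈ Function.support f₂ := Function.mem_support.2 h
      rw [hs₂] at this
      exact this hx2
    have hf1 : f₁ x ≠ 0 := by
      intro h
      exact hpos x (by rw [h, hf2, add_zero])
    simp only [hf2, add_zero, div_self hf1]
  · have hsub : Function.support (fun x => f₁ x / (f₁ x + f₂ x)) ⊆ Metric.thickening (r / 2) K := by
      intro x hx
      rw [← hs₁]
      intro h
      exact hx (by simp only [h, zero_div])
    calc tsupport (fun x => f₁ x / (f₁ x + f₂ x))
        = closure (Function.support fun x => f₁ x / (f₁ x + f₂ x)) := rfl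
      _ ⊆ closure (Metric.thickening (r / 2) K) := closure_mono hsub
      _ ⊆ Metric.cthickening (r / 2) K := Metric.closure_thickening_subset_cthickening _ _
      _ ⊆ Metric.thickening r K := Metric.cthickening_subset_thickening' hr (by linarith) K

omit [FiniteDimensional ℝ E] in
/-- A smooth function with closed support inside an open set `O`, times a function smooth on `O`, is smooth everywhere. [folklore] -/
theorem contDiff_mul_of_tsupport_subset {χ h : E → ℝ} {O : Set E} (hO : IsOpen O) (hχ : ContDiff ℝ ∞ χ)
    (hsupp : tsupport χ ⊆ O) (hh : ContDiffOn ℝ ∞ h O) : ContDiff ℝ ∞ fun x => χ x * h x := by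
  rw [contDiff_iff_contDiffAt]
  intro x
  by_cases hx : x ∈ O
  · exact hχ.contDiffAt.mul (hh.contDiffAt (hO.mem_nhds hx))
  · have hx' : x ∉ tsupport χ := fun h' => hx (hsupp h')
    have hev : (fun y => χ y * h y) =ᶠ[𝓝 x] fun _ => 0 := by
      filter_upwards [(isClosed_tsupport χ).isOpen_compl.mem_nhds hx'] with y hy
      have : χ y = 0 := by
        by_contra hne
        exact hy (subset_tsupport χ (Function.mem_support.2 hne))
      rw [this, zero_mul]
    exact contDiffAt_const.congr_of_eventuallyEq hev

end Cutoff

section Flow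

open Literature.MathematicalPhysics.QuantumFieldTheory.SUNBakryEmery (expSU coe_expSU)

variable {ι : Type u} [Fintype ι] [DecidableEq ι] {N : ℕ}

/-- The one-parameter flow `z ↦ (g_e e^{z V_e})_{e ∈ Xe}` with the links OFF `Xe` frozen at `g_e` (complex parameter). [folklore] -/
def flowCfg (g : PSU ι N) (V : Cfg ι N) (Xe : Finset ι) (z : ℂ) : Cfg ι N :=
  fun e => if e ∈ Xe then (g e : Matrix (Fin N) (Fin N) ℂ) * NormedSpace.exp (z • V e) else (g e : Matrix (Fin N) (Fin N) ℂ)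

omit [Fintype ι] in
/-- The frozen flow `flowCfg g V X̃` is entire in its complex parameter. [folklore] -/
theorem differentiable_flowCfg (g : PSU ι N) (V : Cfg ι N) (Xe : Finset ι) : Differentiable ℂ (flowCfg g V Xe) := by
  refine differentiable_pi.2 fun e => ?_
  by_cases he : e ∈ Xe
  · simp only [flowCfg, he, if_true]
    exact (differentiable_const _).mul fun z => (hasDerivAt_exp_smul_const (V e) z).differentiableAt
  · simp only [flowCfg, he, if_false]
    exact differentiable_const _

/-- The real-parameter flow with frozen links is a group configuration. [folklore] -/
def flowPSU (g : PSU ι N) (V : Cfg ι N) (hV : ∀ e, (V e)ᴴ = -V e) (hV0 : ∀ e, (V e).trace = 0) (Xe : Finset ι)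
    (s : ℝ) : PSU ι N :=
  fun e => if e ∈ Xe then g e * expSU (hV e) (hV0 e) s else g e

omit [Fintype ι] in
/-- At a real parameter the frozen flow is the complexification `emb` of the group element `flowPSU`. [folklore] -/
theorem flowCfg_ofReal (g : PSU ι N) (V : Cfg ι N) (hV : ∀ e, (V e)ᴴ = -V e) (hV0 : ∀ e, (V e).trace = 0)
    (Xe : Finset ι) (s : ℝ) : flowCfg g V Xe (s : ℂ) = emb (flowPSU g V hV hV0 Xe s) := by
  funext e
  by_cases he : e ∈ Xe
  · simp only [flowCfg, flowPSU, he, if_true, emb_apply, Complex.coe_smul]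
    rfl
  · simp only [flowCfg, flowPSU, he, if_false, emb_apply]

/-- On the links of `Xe` the frozen flow agrees with the full flow `g · e^{sV}`. [folklore] -/
theorem flowPSU_eq_of_mem (g : PSU ι N) (V : Cfg ι N) (hV : ∀ e, (V e)ᴴ = -V e) (hV0 : ∀ e, (V e).trace = 0)
    (Xe : Finset ι) (s : ℝ) {e : ι} (he : e ∈ Xe) :
    (flowPSU g V hV hV0 Xe s e : Matrix (Fin N) (Fin N) ℂ) = (emb g * NormedSpace.exp (s • V)) e := by
  rw [show NormedSpace.exp (s • V) = fun i => NormedSpace.exp ((s • V) i) from Pi.exp_def _]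
  simp only [flowPSU, he, if_true, Pi.mul_apply, emb_apply, Pi.smul_apply]
  simp

omit [Fintype ι] in
/-- **The frozen flow stays in the strip**: for `‖z‖ < log (1 + r)` and `‖V_e‖_F ≤ 1` on `Xe`, every link of the flow is
`r`-close (Frobenius) to the corresponding link of `g` (unitary invariance + `‖e^T − 1‖ ≤ e^{‖T‖} − 1`). [folklore] -/
theorem norm_flowCfg_sub_lt (g : PSU ι N) {V : Cfg ι N} {Xe : Finset ι} (hV1 : ∀ e ∈ Xe, ‖V e‖ ≤ 1) {r : ℝ} (hr : 0 < r)
    {z : ℂ} (hz : ‖z‖ < Real.log (1 + r)) (e : ι) :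
    ‖flowCfg g V Xe z e - (g e : Matrix (Fin N) (Fin N) ℂ)‖ < r := by
  by_cases he : e ∈ Xe
  · simp only [flowCfg, he, if_true]
    rw [← mul_sub_one, ← frobNorm_eq_norm, frobNorm_unitary_mul (Matrix.specialUnitaryGroup_le_unitaryGroup (g e).2),
      frobNorm_eq_norm]
    refine (Literature.Analysis.Calculus.ExpDifferential.norm_exp_sub_one_le_exp_norm_sub_one _).trans_lt ?_
    have h1 : ‖z • V e‖ ≤ ‖z‖ := by
      rw [norm_smul]; exact mul_le_of_le_one_right (norm_nonneg _) (hV1 e he)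
    have h2 : Real.exp ‖z • V e‖ < 1 + r := by
      calc Real.exp ‖z • V e‖ ≤ Real.exp ‖z‖ := Real.exp_le_exp.2 h1
        _ < Real.exp (Real.log (1 + r)) := Real.exp_lt_exp.2 hz
        _ = 1 + r := Real.exp_log (by linarith)
    linarith
  · simp only [flowCfg, he, if_false, sub_self, norm_zero]
    exact hr

end Flow

end Summit.Ventures.YMGap.BEDoor
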